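import Summits.QuantumAdvantage.QuantumAdvantage.Theses.HankelLift

/-!
# `HankelLift.DiscToRules` (stmt-QuantumAdvantage-18441): rectangle discrepancy ⇒ rectangle rules fail

Route `route-QuantumAdvantage-HankelLift`, support item `DiscToRules` (provable-now glue):
`HankelDiscrepancy → ∀ᶠ n, ∀ k ≤ n², ∀ (a b : [2^n] → [k]) (g : [k]² → Bool)`, the product-partition
rule `(x, y) ↦ g (a x) (b y)` agrees with `[λ(x+y+2) = −1]` on at most a `1/2 + 1/100` fraction of
`[2^n]²`.

Proof (the standard discrepancy-to-correlation bookkeeping, e.g. Kushilevitz–Nisan §3.5): since `λ(m) ∈ {±1}` for `m ≥ 1`, `2·[rule agrees at (x,y)] = 1 + ε(x,y) λ(x+y+2)`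
with `ε = ∓1` constant on each of the `k²` cells `a⁻¹(i) × b⁻¹(j)`; summing,
`2·#agree = 4^n + ∑_{i,j} ε_{ij} ∑_{a⁻¹(i) × b⁻¹(j)} λ(x+y+2) ≤ 4^n + k²·4^n/n^5 ≤ 4^n (1 + 1/n)`
by `HankelDiscrepancy` at `C = 5` and `k ≤ n²`; for `n ≥ 50` this is `≤ 4^n (1 + 2/100)`.
-/

set_option linter.dupNamespace false -- D-0017: single-problem summit ⇒ `QuantumAdvantage.QuantumAdvantage` by design

namespace Summit.QuantumAdvantage.QuantumAdvantage.Theorems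

open Finset Filter
open Summit.QuantumAdvantage.QuantumAdvantage.Theses.HankelLift

/-- The pointwise identity behind discrepancy ⇒ correlation: for `m ≠ 0` and a predicted bit `g`,
`2·[g = [λ(m) = −1]] = 1 + ε·λ(m)` with `ε = −1` if `g` predicts `λ = −1` and `ε = +1` otherwise.
[folklore] -/
theorem two_mul_ite_agree_eq (g : Bool) {m : ℕ} (hm : m ≠ 0) :
    (2 : ℝ) * (if g = decide (ArithmeticFunction.liouville m = -1) then 1 else 0) =
      1 + (if g then -1 else 1) * ((ArithmeticFunction.liouville m : ℤ) : ℝ) := by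
  -- `λ(m) = (−1)^{Ω(m)} ∈ {±1}` (cf. `MobiusLadder.liouville_eq_one_or_eq_neg_one`)
  rw [ArithmeticFunction.liouville_apply hm]
  rcases neg_one_pow_eq_or ℤ (ArithmeticFunction.cardFactors m) with h | h <;> cases g <;>
    simp [h] <;> norm_num

/-- **`DiscToRules`** (stmt-QuantumAdvantage-18441): the rectangle-discrepancy bound
`HankelDiscrepancy` implies that, for all large `n`, every product-partition rule with `k ≤ n²`
labels a side agrees with `[λ(x+y+2) = −1]` on at most a `1/2 + 1/100` fraction of `[2^n]²`
(sum the `k²` cell discrepancies with `C = 5`; `n ≥ 50`).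
[cite: KushilevitzNisan1996, §3.5 (discrepancy)] -/
theorem discToRules_proof : DiscToRules := by
  intro hD
  filter_upwards [hD 5, eventually_ge_atTop 50] with n hn h50 k hk a b g
  classical
  -- the agreement set and the two weights
  set A := (Finset.univ.filter fun p : Fin (2 ^ n) × Fin (2 ^ n) =>
      g (a p.1) (b p.2) = decide (ArithmeticFunction.liouville (p.1.val + p.2.val + 2) = -1))
    with hA
  have hcardU : ((Finset.univ : Finset (Fin (2 ^ n) × Fin (2 ^ n))).card : ℝ) = (4 : ℝ) ^ n := by
    rw [Finset.card_univ, Fintype.card_prod, Fintype.card_fin]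
    push_cast
    rw [← mul_pow]
    norm_num
  have hn0 : (0 : ℝ) < n := by exact_mod_cast (by omega : 0 < n)
  -- step 1: `2·#A = 4^n + ∑ ε λ`
  have h1 : 2 * (A.card : ℝ) = (4 : ℝ) ^ n +
      ∑ p : Fin (2 ^ n) × Fin (2 ^ n), (if g (a p.1) (b p.2) then (-1 : ℝ) else 1) *
        ((ArithmeticFunction.liouville (p.1.val + p.2.val + 2) : ℤ) : ℝ) := by
    rw [hA, Finset.card_filter]
    push_cast
    rw [Finset.mul_sum, ← hcardU, Finset.card_eq_sum_ones]
    push_cast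
    rw [← Finset.sum_add_distrib]
    refine Finset.sum_congr rfl fun p _ => ?_
    exact two_mul_ite_agree_eq _ (by omega)
  -- step 2: group the correlation sum by the `k²` cells
  have h2 : ∑ p : Fin (2 ^ n) × Fin (2 ^ n), (if g (a p.1) (b p.2) then (-1 : ℝ) else 1) *
        ((ArithmeticFunction.liouville (p.1.val + p.2.val + 2) : ℤ) : ℝ) =
      ∑ ij : Fin k × Fin k, (if g ij.1 ij.2 then (-1 : ℝ) else 1) *
        ∑ x ∈ Finset.univ.filter (fun x : Fin (2 ^ n) => a x = ij.1),
          ∑ y ∈ Finset.univ.filter (fun y : Fin (2 ^ n) => b y = ij.2),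
            ((ArithmeticFunction.liouville (x.val + y.val + 2) : ℤ) : ℝ) := by
    rw [← Finset.sum_fiberwise Finset.univ (fun p : Fin (2 ^ n) × Fin (2 ^ n) => (a p.1, b p.2))]
    refine Finset.sum_congr rfl fun ij _ => ?_
    have hfib : (Finset.univ.filter fun p : Fin (2 ^ n) × Fin (2 ^ n) => (a p.1, b p.2) = ij) =
        (Finset.univ.filter fun x : Fin (2 ^ n) => a x = ij.1) ×ˢ
          (Finset.univ.filter fun y : Fin (2 ^ n) => b y = ij.2) := by
      ext p
      simp only [Finset.mem_filter, Finset.mem_univ, true_and, Finset.mem_product, Prod.ext_iff]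
    rw [hfib, Finset.sum_product, Finset.mul_sum]
    refine Finset.sum_congr rfl fun x hx => ?_
    rw [Finset.mul_sum]
    refine Finset.sum_congr rfl fun y hy => ?_
    simp only [Finset.mem_filter, Finset.mem_univ, true_and] at hx hy
    rw [hx, hy]
  -- step 3: each cell contributes at most `4^n/n^5`, and there are `k² ≤ n⁴` cells
  have h3 : |∑ p : Fin (2 ^ n) × Fin (2 ^ n), (if g (a p.1) (b p.2) then (-1 : ℝ) else 1) *
        ((ArithmeticFunction.liouville (p.1.val + p.2.val + 2) : ℤ) : ℝ)| ≤ (4 : ℝ) ^ n / n := by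
    rw [h2]
    refine (Finset.abs_sum_le_sum_abs _ _).trans ?_
    have hcell : ∀ ij : Fin k × Fin k, |(if g ij.1 ij.2 then (-1 : ℝ) else 1) *
        ∑ x ∈ Finset.univ.filter (fun x : Fin (2 ^ n) => a x = ij.1),
          ∑ y ∈ Finset.univ.filter (fun y : Fin (2 ^ n) => b y = ij.2),
            ((ArithmeticFunction.liouville (x.val + y.val + 2) : ℤ) : ℝ)| ≤
        (4 : ℝ) ^ n / (n : ℝ) ^ 5 := by
      intro ij
      rw [abs_mul]
      have he : |(if g ij.1 ij.2 then (-1 : ℝ) else 1)| = 1 := by split_ifs <;> simp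
      rw [he, one_mul]
      exact hn _ _
    refine (Finset.sum_le_sum fun ij _ => hcell ij).trans ?_
    rw [Finset.sum_const, Finset.card_univ, Fintype.card_prod, Fintype.card_fin, nsmul_eq_mul]
    push_cast
    have hk' : (k : ℝ) ≤ (n : ℝ) ^ 2 := by exact_mod_cast hk
    calc (k : ℝ) * k * ((4 : ℝ) ^ n / (n : ℝ) ^ 5)
        ≤ (n : ℝ) ^ 2 * (n : ℝ) ^ 2 * ((4 : ℝ) ^ n / (n : ℝ) ^ 5) := by gcongr
      _ = (4 : ℝ) ^ n / n := by field_simp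
  -- step 4: conclude
  rw [hcardU, div_le_iff₀ (by positivity)]
  have h50' : (50 : ℝ) ≤ n := by exact_mod_cast h50
  have hdiv : (4 : ℝ) ^ n / n ≤ (4 : ℝ) ^ n / 50 :=
    div_le_div_of_nonneg_left (by positivity) (by norm_num) h50'
  have hle := le_abs_self (∑ p : Fin (2 ^ n) × Fin (2 ^ n),
    (if g (a p.1) (b p.2) then (-1 : ℝ) else 1) *
      ((ArithmeticFunction.liouville (p.1.val + p.2.val + 2) : ℤ) : ℝ))
  linarith

end Summit.QuantumAdvantage.QuantumAdvantage.Theorems
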